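import Mathlib.Tactic
import Literature.Computability.AlgebraicComplexity.SyntacticMultilinearExtension
import Literature.Computability.AlgebraicComplexity.SetMultilinear
import Summits.ValiantsHypothesis.ValiantsHypothesis.Theorems.DepthFourLinearise
import HarnessLib

/-!
# Depth-4 row-set-multilinear expressions with linear bottoms are small syntactically
# multilinear circuits — the ladder edge `A_c ⟹ A^ΣΠΣΠ_c` of NODE-v3, typed
(decomposition workshop `decomp-valiant`, lens 6, gen 3)

A linear-bottom depth-4 row-set-multilinear expression `per_n = Σ_t Π_b Σ_u Π_{i ∈ b} ℓ_{t,b,u,i}`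
of size `W = Σ_t w_t` (`Theorems.DepthFourLinearise.PerRowSmlDepthFourLinHardExp`) is compiled gate
by gate (`Literature…SynAvail`) into a plain fan-in-two SYNTACTICALLY MULTILINEAR circuit of size
`≤ (2n² + 3n + 1) · W` (`exists_smCircuit_of_depthFour_linear`): linear forms cost `2n` gates, the
product over the rows of a block multiplies factors with disjoint supports `{i} × [n]`, the product
over the blocks of a term multiplies factors on disjoint row sets, and terms with `w_t = 0` vanish.
Hence the sm-circuit statement `PerSmHardExp c` (unfolded, as in `Theorems.ColumnSubsetDP`)
implies the depth-4 rungs (`perRowSmlDepthFourHardExp_of_perSmHardExp`): with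
`Theorems.SmThreshold.perRowLocalHardExp_of_depthFour` the A-side ladder
`A_c ⟹ A^ΣΠΣΠ_c ⟹ A^ΣΠ_c` is entirely in the kernel.
HONEST FRAMING: circuit constructions and implications between hardness statements; nothing here
is evidence for `VP ≠ VNP`, which is NOT proved; `PerSmHardExp c` is OPEN for `c ≥ 3`.

## References
* [RazYehudayoff2008] R. Raz, A. Yehudayoff, Comput. Complexity 17 (2008), §2.
* [RazYehudayoff2009] R. Raz, A. Yehudayoff, Comput. Complexity 18 (2009), §2.
-/

-- layout Summits/ValiantsHypothesis/ValiantsHypothesis forces the duplicated namespace component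
set_option linter.dupNamespace false

namespace Summit.ValiantsHypothesis.ValiantsHypothesis.Theorems.DepthFourCircuit

open Finset MvPolynomial Literature.Computability.AlgebraicComplexity
  Literature.Computability.AlgebraicComplexity.ArithCircuit
  Literature.Computability.AlgebraicComplexity.SynAvail
open Literature.Barriers.ValiantsHypothesis (IsPlainGate)
open Summit.ValiantsHypothesis.ValiantsHypothesis.Theorems.RowSmlDepthFour
open Summit.ValiantsHypothesis.ValiantsHypothesis.Theorems.GlueLeafCount
open Summit.ValiantsHypothesis.ValiantsHypothesis.Theorems.DepthFourLinearise

noncomputable section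

variable {F : Type*} [Field F]

/-! ### Bookkeeping predicates (the shapes of `Literature…SynAvail`) -/

/-- A plain fan-in-two gate list satisfying the product-gate invariant (gate-list form of
syntactic multilinearity). [cite: RazYehudayoff2008, §2] -/
def Good {σ : Type*} [DecidableEq σ] (gs : List (Gate F σ)) : Prop :=
  (∀ g ∈ gs, g.fanIn ≤ 2 ∧ IsPlainGate g) ∧
    ∀ (i : ℕ) (args : List (Operand F σ)), gs[i]? = some (.prod args) →
      (args.map (operandVarSet (gateVarSets (gs.take i)))).Pairwise Disjoint

/-- `p` is available in `gs` with syntactic support inside `V`. [cite: RazYehudayoff2008, §2] -/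
def Avail {σ : Type*} [DecidableEq σ] (gs : List (Gate F σ)) (p : MvPolynomial σ F)
    (V : Finset σ) : Prop :=
  ∃ u : Operand F σ, u.RefsBelow gs.length ∧ u.eval (gateValues gs) = p ∧
    operandVarSet (gateVarSets gs) u ⊆ V

/-- `p` can be MADE available with support `V` at the cost of `cost` gates, from any good list,
keeping the list good. [cite: RazYehudayoff2008, §2] -/
def Makeable {σ : Type*} [DecidableEq σ] (p : MvPolynomial σ F) (V : Finset σ) (cost : ℕ) : Prop :=
  ∀ gs : List (Gate F σ), Good gs →
    ∃ gs' : List (Gate F σ), gs <+: gs' ∧ Good gs' ∧ gs'.length ≤ gs.length + cost ∧ Avail gs' p V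

section Generic

variable {σ : Type*} [DecidableEq σ]

/-- Monotonicity of `Makeable` in the cost and the support. [folklore] -/
theorem Makeable.mono {p : MvPolynomial σ F} {V W : Finset σ} {c c' : ℕ} (hVW : V ⊆ W)
    (hc : c ≤ c') (h : Makeable p V c) : Makeable p W c' := by
  intro gs hgs
  obtain ⟨gs', hp, hg, hl, hav⟩ := h gs hgs
  exact ⟨gs', hp, hg, hl.trans (by omega), savail_weaken hVW hav⟩

/-- Transport of `Makeable` along an equality of targets. [folklore] -/
theorem Makeable.congr {p q : MvPolynomial σ F} {V : Finset σ} {c : ℕ} (hpq : p = q)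
    (h : Makeable p V c) : Makeable q V c := hpq ▸ h

/-- Constants are makeable for free. [cite: RazYehudayoff2008, §2] -/
theorem makeable_C (a : F) (V : Finset σ) : Makeable (C a : MvPolynomial σ F) V 0 :=
  fun gs hgs => ⟨gs, List.prefix_rfl, hgs, by simp, savail_C gs a V⟩

/-- `C a * X v` is makeable with one gate and support `{v}` (inside `V`). [cite: RazYehudayoff2008, §2] -/
theorem makeable_C_mul_X (a : F) (v : σ) {V : Finset σ} (hv : v ∈ V) :
    Makeable (C a * X v : MvPolynomial σ F) V 1 := by
  intro gs hgs
  obtain ⟨gs', hp, hg, hm, hl, hav⟩ := sextend_smul a hgs.1 hgs.2 (savail_X gs v hv)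
  exact ⟨gs', hp, ⟨hg, hm⟩, hl, hav⟩

/-- **Sums.** If each `P k` is makeable with support `V` at cost `cost k`, then `Σ_{k ∈ K} P k` is
makeable with support `V` at cost `Σ_{k ∈ K} (cost k + 1)`. [cite: RazYehudayoff2008, §2] -/
theorem makeable_sum {κ : Type*} [DecidableEq κ] (K : Finset κ) (P : κ → MvPolynomial σ F)
    (V : Finset σ) (cost : κ → ℕ) (h : ∀ k ∈ K, Makeable (P k) V (cost k)) :
    Makeable (∑ k ∈ K, P k) V (∑ k ∈ K, (cost k + 1)) := by
  induction K using Finset.induction_on with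
  | empty =>
    rw [Finset.sum_empty, Finset.sum_empty, ← C_0]
    exact makeable_C 0 V
  | insert a K ha ih =>
    intro gs hgs
    obtain ⟨gs₁, hp₁, hg₁, hl₁, hav₁⟩ := ih (fun k hk => h k (mem_insert_of_mem hk)) gs hgs
    obtain ⟨gs₂, hp₂, hg₂, hl₂, hav₂⟩ := h a (mem_insert_self _ _) gs₁ hg₁
    obtain ⟨gs₃, hp₃, hg₃, hm₃, hl₃, hav₃⟩ :=
      sextend_add hg₂.1 hg₂.2 hav₂ (savail_mono hp₂ hav₁)
    refine ⟨gs₃, hp₁.trans (hp₂.trans hp₃), ⟨hg₃, hm₃⟩, ?_, ?_⟩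
    · rw [Finset.sum_insert ha]; omega
    · rw [Finset.sum_insert ha]
      exact savail_weaken (Finset.union_subset Subset.rfl Subset.rfl) hav₃

/-- **Products on disjoint supports.** If each `P k` is makeable with support `A k ×ˢ univ` at
cost `cost k`, the `A k` pairwise disjoint, then `Π_{k ∈ K} P k` is makeable with support
`(⋃ A k) ×ˢ univ` at cost `Σ_{k ∈ K} (cost k + 1)` — every product gate multiplies operands with
disjoint syntactic supports. [cite: RazYehudayoff2008, §2] -/
theorem makeable_prod {n : ℕ} {κ : Type*} [DecidableEq κ] (K : Finset κ)
    (P : κ → MvPolynomial (Fin n × Fin n) F) (A : κ → Finset (Fin n))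
    (hA : ∀ k ∈ K, ∀ k' ∈ K, k ≠ k' → Disjoint (A k) (A k')) (cost : κ → ℕ)
    (h : ∀ k ∈ K, Makeable (P k) (A k ×ˢ (univ : Finset (Fin n))) (cost k))
    (S : Finset (Fin n)) (hS : K.biUnion A = S) :
    Makeable (∏ k ∈ K, P k) (S ×ˢ (univ : Finset (Fin n))) (∑ k ∈ K, (cost k + 1)) := by
  subst hS
  induction K using Finset.induction_on with
  | empty =>
    rw [Finset.prod_empty, Finset.sum_empty, ← C_1]
    exact makeable_C 1 _
  | insert a K ha ih =>
    have hA' : ∀ k ∈ K, ∀ k' ∈ K, k ≠ k' → Disjoint (A k) (A k') :=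
      fun k hk k' hk' => hA k (mem_insert_of_mem hk) k' (mem_insert_of_mem hk')
    have hU : Disjoint (A a) (K.biUnion A) := by
      rw [Finset.disjoint_biUnion_right]
      intro k hk
      exact hA a (mem_insert_self _ _) k (mem_insert_of_mem hk) (fun h => ha (h ▸ hk))
    intro gs hgs
    obtain ⟨gs₁, hp₁, hg₁, hl₁, hav₁⟩ := ih hA' (fun k hk => h k (mem_insert_of_mem hk)) gs hgs
    obtain ⟨gs₂, hp₂, hg₂, hl₂, hav₂⟩ := h a (mem_insert_self _ _) gs₁ hg₁
    obtain ⟨gs₃, hp₃, hg₃, hm₃, hl₃, hav₃⟩ :=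
      sextend_mul hg₂.1 hg₂.2 (Finset.disjoint_product.2 (Or.inl hU)) hav₂ (savail_mono hp₂ hav₁)
    refine ⟨gs₃, hp₁.trans (hp₂.trans hp₃), ⟨hg₃, hm₃⟩, ?_, ?_⟩
    · rw [Finset.sum_insert ha]; omega
    · rw [Finset.prod_insert ha, Finset.biUnion_insert]
      refine savail_weaken (Finset.union_subset ?_ ?_) hav₃
      · exact Finset.product_subset_product_left Finset.subset_union_left
      · exact Finset.product_subset_product_left Finset.subset_union_right

end Generic

/-! ### Linear forms in one row -/

/-- A polynomial set-multilinear over the single block `{i}` (w.r.t. rows) is a linear form in the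
variables of row `i`. [cite: LimayeSrinivasanTavenas2025, §2] -/
theorem eq_sum_C_mul_X_of_isSetMultilinear_singleton {n : ℕ} (i : Fin n)
    (p : MvPolynomial (Fin n × Fin n) F) (hp : IsSetMultilinear Prod.fst {i} p) :
    p = ∑ j : Fin n, C (coeff (Finsupp.single (i, j) 1) p) * X (i, j) := by
  classical
  have key : ∀ d ∈ p.support, ∃ j : Fin n, d = Finsupp.single (i, j) 1 := by
    intro d hd
    have hw := hp (mem_support_iff.mp hd)
    have hscal : ∀ i' : Fin n, ∑ x ∈ d.support, d x • (if x.1 = i' then 1 else 0) =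
        if i' = i then 1 else 0 := by
      intro i'
      have h1 : (Finsupp.weight (blockWeight Prod.fst) d) i' =
          (blockProfile ({i} : Finset (Fin n))) i' := congrArg (fun f => f i') hw
      rw [weight_blockWeight_apply_eq, Finsupp.weight_apply, Finsupp.sum, blockProfile_apply] at h1
      simpa [Finset.mem_singleton] using h1
    have hall : ∀ x ∈ d.support, x.1 = i := by
      intro x hx
      by_contra hne
      have h0 := hscal x.1
      rw [if_neg hne] at h0
      have hle := Finset.single_le_sum (f := fun y => d y • (if y.1 = x.1 then 1 else 0))
        (fun _ _ => Nat.zero_le _) hx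
      rw [h0, if_pos rfl, smul_eq_mul, mul_one] at hle
      exact (Finsupp.mem_support_iff.mp hx) (Nat.le_zero.mp hle)
    have hsum1 : ∑ x ∈ d.support, d x = 1 := by
      have h1 := hscal i
      rw [if_pos rfl] at h1
      rw [← h1]
      refine Finset.sum_congr rfl fun x hx => ?_
      rw [if_pos (hall x hx), smul_eq_mul, mul_one]
    have hd0 : d ≠ 0 := by
      rintro rfl
      simp at hsum1
    have hcard : d.support.card ≤ 1 := by
      calc d.support.card = ∑ x ∈ d.support, 1 := by simp
        _ ≤ ∑ x ∈ d.support, d x :=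
            Finset.sum_le_sum fun x hx => Nat.one_le_iff_ne_zero.mpr (Finsupp.mem_support_iff.mp hx)
        _ = 1 := hsum1
    obtain ⟨v, hv⟩ := Finsupp.support_nonempty_iff.mpr hd0
    have hsupp : d.support = {v} :=
      Finset.eq_singleton_iff_unique_mem.mpr ⟨hv, fun x hx => Finset.card_le_one.mp hcard x hx v hv⟩
    have hdv : d v = 1 := by
      rw [hsupp, Finset.sum_singleton] at hsum1
      exact hsum1
    refine ⟨v.2, ?_⟩
    have hvi : v = (i, v.2) := Prod.ext (hall v hv) rfl
    rw [← hvi]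
    exact Finsupp.eq_single_iff.mpr ⟨hsupp.le, hdv⟩
  ext d
  simp only [coeff_sum, coeff_C_mul, coeff_X]
  by_cases hd : d ∈ p.support
  · obtain ⟨j₀, rfl⟩ := key d hd
    rw [Finset.sum_eq_single j₀]
    · simp
    · intro j _ hj
      rw [if_neg, mul_zero]
      intro h
      exact hj (Prod.mk.inj ((Finsupp.single_left_inj one_ne_zero).mp h)).2
    · intro h; exact absurd (mem_univ _) h
  · rw [notMem_support_iff.mp hd]
    symm
    refine Finset.sum_eq_zero fun j _ => ?_
    split_ifs with h
    · rw [h, notMem_support_iff.mp hd, mul_one]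
    · rw [mul_zero]

/-- A row-`i` linear form is makeable with `2n` gates and support `{i} × [n]`. [cite: RazYehudayoff2008, §2] -/
theorem makeable_linear {n : ℕ} (i : Fin n) (p : MvPolynomial (Fin n × Fin n) F)
    (hp : IsSetMultilinear Prod.fst {i} p) :
    Makeable p (({i} : Finset (Fin n)) ×ˢ (univ : Finset (Fin n))) (2 * n) := by
  classical
  have h := makeable_sum (univ : Finset (Fin n))
    (fun j => C (coeff (Finsupp.single (i, j) 1) p) * X (i, j))
    (({i} : Finset (Fin n)) ×ˢ (univ : Finset (Fin n))) (fun _ => 1)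
    (fun j _ => makeable_C_mul_X _ (i, j) (by simp))
  rw [← eq_sum_C_mul_X_of_isSetMultilinear_singleton i p hp] at h
  exact h.mono Subset.rfl (by simp only [Finset.sum_const, Finset.card_univ, Fintype.card_fin, smul_eq_mul]; omega)

/-! ### Compiling one term and the whole expression -/

/-- One term `Π_b Σ_u Π_{i ∈ b} ℓ_{t,b,u,i}` with linear bottoms and `w_t ≥ 1` is makeable with full
support at cost `≤ (2n² + 3n) · w_t`. [cite: RazYehudayoff2008, §2] -/
theorem makeable_term (n : ℕ) (wt : ℕ) (hwt : 1 ≤ wt) (p : Fin n → Fin n)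
    (q : Fin n → Fin wt → Fin n → MvPolynomial (Fin n × Fin n) F)
    (hlin : ∀ b u i, IsSetMultilinear Prod.fst {i} (q b u i)) :
    Makeable (∏ b ∈ univ.image p, ∑ u : Fin wt, ∏ i ∈ univ.filter (fun i => p i = b), q b u i)
      ((univ : Finset (Fin n)) ×ˢ (univ : Finset (Fin n))) ((2 * n * n + 3 * n) * wt) := by
  classical
  have hinner : ∀ b u, Makeable (∏ i ∈ univ.filter (fun i => p i = b), q b u i)
      ((univ.filter fun i => p i = b) ×ˢ (univ : Finset (Fin n)))
      (∑ i ∈ univ.filter (fun i => p i = b), (2 * n + 1)) := by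
    intro b u
    exact makeable_prod (univ.filter fun i => p i = b) (fun i => q b u i)
      (fun i => ({i} : Finset (Fin n)))
      (fun i _ i' _ hii' => Finset.disjoint_singleton.2 hii') (fun _ => 2 * n)
      (fun i _ => makeable_linear i (q b u i) (hlin b u i)) _ Finset.biUnion_singleton_eq_self
  have hmid : ∀ b ∈ univ.image p,
      Makeable (∑ u : Fin wt, ∏ i ∈ univ.filter (fun i => p i = b), q b u i)
        ((univ.filter fun i => p i = b) ×ˢ (univ : Finset (Fin n)))
        (∑ u : Fin wt, ((univ.filter fun i => p i = b).card * (2 * n + 1) + 1)) := by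
    intro b _
    refine makeable_sum (univ : Finset (Fin wt)) _ _ _ fun u _ => ?_
    have h := hinner b u
    rw [Finset.sum_const, smul_eq_mul] at h
    exact h
  have hfib : ∀ b ∈ univ.image p, ∀ b' ∈ univ.image p, b ≠ b' →
      Disjoint (univ.filter fun i => p i = b) (univ.filter fun i => p i = b') := by
    intro b _ b' _ hbb'
    rw [Finset.disjoint_filter]
    intro i _ hib hib'
    exact hbb' (hib.symm.trans hib')
  have hcov : (univ.image p).biUnion (fun b => univ.filter fun i => p i = b) =
      (univ : Finset (Fin n)) := by
    ext i
    simp only [Finset.mem_univ, Finset.mem_biUnion, Finset.mem_image, Finset.mem_filter,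
      true_and, iff_true]
    exact ⟨p i, ⟨i, rfl⟩, rfl⟩
  have h := makeable_prod (univ.image p) _ (fun b => univ.filter fun i => p i = b) hfib _ hmid
    univ hcov
  refine h.mono Subset.rfl ?_
  have hsumcard : ∑ b ∈ univ.image p, (univ.filter fun i => p i = b).card = n := by
    rw [← Finset.card_eq_sum_card_image p univ, Finset.card_univ, Fintype.card_fin]
  have hB : (univ.image p).card ≤ n :=
    Finset.card_image_le.trans (by rw [Finset.card_univ, Fintype.card_fin])
  simp only [Finset.sum_const, smul_eq_mul, Finset.card_univ, Fintype.card_fin]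
  rw [Finset.sum_add_distrib, Finset.sum_const, smul_eq_mul, mul_one, ← Finset.mul_sum,
    Finset.sum_add_distrib, Finset.sum_const, smul_eq_mul, mul_one, ← Finset.sum_mul, hsumcard]
  set B := (univ.image p).card with hBdef
  have h1 : wt * (n * (2 * n + 1) + B) + B ≤ wt * (n * (2 * n + 1) + n) + n * wt := by
    have : B ≤ n * wt := hB.trans (Nat.le_mul_of_pos_right n hwt)
    nlinarith
  calc wt * (n * (2 * n + 1) + B) + B ≤ wt * (n * (2 * n + 1) + n) + n * wt := h1
    _ = (2 * n * n + 3 * n) * wt := by ring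

/-- A term with `w_t = 0` vanishes (there is at least one block when `n ≥ 1`). [folklore] -/
theorem term_eq_zero_of_width_zero (n : ℕ) (hn : 1 ≤ n) (wt : ℕ) (hwt : wt = 0) (p : Fin n → Fin n)
    (q : Fin n → Fin wt → Fin n → MvPolynomial (Fin n × Fin n) F) :
    (∏ b ∈ univ.image p, ∑ u : Fin wt, ∏ i ∈ univ.filter (fun i => p i = b), q b u i) = 0 := by
  classical
  have i₀ : Fin n := ⟨0, hn⟩
  refine Finset.prod_eq_zero (Finset.mem_image_of_mem p (mem_univ i₀)) ?_
  exact Finset.sum_eq_zero fun u _ => by exfalso; have := u.isLt; omega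

/-- **The compilation.** A linear-bottom depth-4 row-set-multilinear expression for `per_n`
(`n ≥ 1`) of size `W = Σ_t w_t` yields a plain fan-in-two syntactically multilinear circuit for
`per_n` of size `≤ (2n² + 3n + 1) · W`. [cite: RazYehudayoff2008, §2; RazYehudayoff2009, §2] -/
theorem exists_smCircuit_of_depthFour_linear (n s : ℕ) (hn : 1 ≤ n) (w : Fin s → ℕ)
    (π : Fin s → Fin n → Fin n)
    (q : (t : Fin s) → Fin n → Fin (w t) → Fin n → MvPolynomial (Fin n × Fin n) F)
    (hlin : ∀ t b u i, IsSetMultilinear Prod.fst {i} (q t b u i))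
    (h : perPoly (Fin n) F = depthFourEval n s w π q) :
    ∃ P : ArithCircuit F (Fin n × Fin n), P.IsFanInTwo ∧ IsSyntacticallyMultilinear P ∧
      P.Computes (perPoly (Fin n) F) ∧ P.size ≤ (2 * n * n + 3 * n + 1) * ∑ t, w t := by
  classical
  set T := (univ : Finset (Fin s)).filter (fun t => 0 < w t) with hT
  have hsplit : depthFourEval n s w π q =
      ∑ t ∈ T, ∏ b ∈ univ.image (π t), ∑ u : Fin (w t),
        ∏ i ∈ univ.filter (fun i => π t i = b), q t b u i := by
    unfold depthFourEval
    rw [hT, Finset.sum_filter_of_ne]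
    intro t _ hne
    by_contra h0
    exact hne (term_eq_zero_of_width_zero n hn (w t) (by omega) (π t) (q t))
  have hterms : ∀ t ∈ T, Makeable (∏ b ∈ univ.image (π t), ∑ u : Fin (w t),
      ∏ i ∈ univ.filter (fun i => π t i = b), q t b u i)
      ((univ : Finset (Fin n)) ×ˢ (univ : Finset (Fin n))) ((2 * n * n + 3 * n) * w t) := by
    intro t ht
    exact makeable_term n (w t) (Finset.mem_filter.mp ht).2 (π t) (q t) (hlin t)
  have hall := makeable_sum T _ _ _ hterms
  rw [← hsplit, ← h] at hall
  obtain ⟨gs, -, hg, hl, u, -, hue, -⟩ := hall [] ⟨fun g hg => by simp at hg, prodInv_nil⟩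
  refine ⟨⟨gs, u⟩, fun g hg' => (hg.1 g hg').1, isSyntacticallyMultilinear_of_prodInv hg.2 u, hue, ?_⟩
  change gs.length ≤ _
  refine (by simpa using hl : gs.length ≤ ∑ t ∈ T, ((2 * n * n + 3 * n) * w t + 1)).trans ?_
  calc ∑ t ∈ T, ((2 * n * n + 3 * n) * w t + 1)
      ≤ ∑ t ∈ T, (2 * n * n + 3 * n + 1) * w t :=
        Finset.sum_le_sum fun t ht => by
          have h1 : 1 ≤ w t := (Finset.mem_filter.mp ht).2
          nlinarith
    _ ≤ ∑ t, (2 * n * n + 3 * n + 1) * w t :=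
        Finset.sum_le_sum_of_subset_of_nonneg (Finset.filter_subset _ _) fun _ _ _ => Nat.zero_le _
    _ = (2 * n * n + 3 * n + 1) * ∑ t, w t := (Finset.mul_sum _ _ _).symm

/-! ### The ladder edge -/

/-- **`A_c ⟹ A^ΣΠΣΠ_c` (linear bottoms).** The sm-circuit hardness statement `PerSmHardExp c` of
`Theorems.SmThreshold` (stated unfolded) implies the linear-bottom depth-4 rung.
[cite: RazYehudayoff2009, §2] -/
theorem perRowSmlDepthFourLinHardExp_of_perSmHardExp (c : ℕ)
    (hA : ∀ a : ℕ, ∃ m : ℕ, ∀ P : ArithCircuit ℂ (Fin (m * c) × Fin (m * c)), P.IsFanInTwo →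
      IsSyntacticallyMultilinear P → P.Computes (perPoly (Fin (m * c)) ℂ) →
      a * (m + 1) ^ a * 4 ^ m < P.size) :
    PerRowSmlDepthFourLinHardExp c := by
  classical
  intro a
  obtain ⟨m, hm⟩ := hA (6 * c * c * a + a + 2)
  refine ⟨m, fun s w π q _ hlin h => ?_⟩
  by_contra hW
  push Not at hW
  rcases Nat.eq_zero_or_pos (m * c) with hn0 | hnpos
  · -- degenerate `n = 0`: the constant circuit has size `0`
    have hP : (⟨[], .const 1⟩ : ArithCircuit ℂ (Fin (m * c) × Fin (m * c))).Computes
        (perPoly (Fin (m * c)) ℂ) := by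
      haveI : IsEmpty (Fin (m * c)) := by rw [hn0]; infer_instance
      change Operand.eval (gateValues []) (.const 1) = perPoly (Fin (m * c)) ℂ
      rw [perPoly, Matrix.permanent_isEmpty]
      rfl
    have hlt := hm ⟨[], .const 1⟩ (fun g hg => by simp at hg) prodInv_nil hP
    exact absurd hlt (Nat.not_lt.mpr (Nat.zero_le _))
  · obtain ⟨P, h2, hsm, hf, hs⟩ :=
      exists_smCircuit_of_depthFour_linear (m * c) s hnpos w π q hlin h
    have hlt := hm P h2 hsm hf
    have hn : m * c ≤ c * (m + 1) := by nlinarith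
    have h6 : 2 * (m * c) * (m * c) + 3 * (m * c) + 1 ≤ 6 * (c * (m + 1)) * (c * (m + 1)) := by
      have : 1 ≤ c * (m + 1) := by nlinarith
      nlinarith
    have hsize : P.size ≤ 6 * (c * (m + 1)) * (c * (m + 1)) * (a * (m + 1) ^ a * 4 ^ m) :=
      hs.trans (Nat.mul_le_mul h6 hW)
    have hpow : (m + 1) ^ (a + 2) ≤ (m + 1) ^ (6 * c * c * a + a + 2) :=
      Nat.pow_le_pow_right (Nat.succ_pos m) (by omega)
    have hfinal : 6 * (c * (m + 1)) * (c * (m + 1)) * (a * (m + 1) ^ a * 4 ^ m) ≤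
        (6 * c * c * a + a + 2) * (m + 1) ^ (6 * c * c * a + a + 2) * 4 ^ m := by
      calc 6 * (c * (m + 1)) * (c * (m + 1)) * (a * (m + 1) ^ a * 4 ^ m)
          = (6 * c * c * a) * (m + 1) ^ (a + 2) * 4 ^ m := by ring
        _ ≤ (6 * c * c * a + a + 2) * (m + 1) ^ (6 * c * c * a + a + 2) * 4 ^ m :=
          Nat.mul_le_mul (Nat.mul_le_mul (by omega) hpow) le_rfl
    omega

/-- **`A_c ⟹ A^ΣΠΣΠ_c`.** The sm-circuit hardness statement `PerSmHardExp c` (unfolded) implies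
the depth-4 rung `PerRowSmlDepthFourHardExp c` of `Theorems.RowSmlDepthFour`; with
`Theorems.SmThreshold.perRowLocalHardExp_of_depthFour` the whole A-side ladder
`A_c ⟹ A^ΣΠΣΠ_c ⟹ A^ΣΠ_c` is in the kernel. [cite: RazYehudayoff2009, §2] -/
theorem perRowSmlDepthFourHardExp_of_perSmHardExp (c : ℕ)
    (hA : ∀ a : ℕ, ∃ m : ℕ, ∀ P : ArithCircuit ℂ (Fin (m * c) × Fin (m * c)), P.IsFanInTwo →
      IsSyntacticallyMultilinear P → P.Computes (perPoly (Fin (m * c)) ℂ) →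
      a * (m + 1) ^ a * 4 ^ m < P.size) :
    PerRowSmlDepthFourHardExp c :=
  (perRowSmlDepthFourHardExp_iff_linear c).2 (perRowSmlDepthFourLinHardExp_of_perSmHardExp c hA)

end

end Summit.ValiantsHypothesis.ValiantsHypothesis.Theorems.DepthFourCircuit
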